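import Mathlib
import Summits.Ventures.HodgeRepro2.T5MeasureDistribution

/-!
# T5DistributionMeasure — every bounded compatible distribution on ℤ_p IS a bounded measure:
the Riemann-sum construction, closing the GAP of T5MeasureDistribution

Tier-5 support for route-3's §G (route/T5-CHECK-G-p7.md §20.2: «that the Katz branch measure is
such an m» — the print's W[[Γ_𝔭]] = lim_k W[Γ_𝔭/Γ_𝔭^{p^k}] versus the model's bounded functionals on
C(Γ_𝔭, W)).  T5MeasureDistribution sends a bounded functional `m` to its values on the residue
classes (`dist m`, a `Distribution`: compatible + bounded) and proves the map injective.  This file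
builds the inverse: for a `Distribution d` and a continuous `φ : ℤ_p → A`, the level-`k` Riemann sum
`riemann d φ k := Σ_{a ∈ ℤ/p^k} φ(â) · d(a + p^kℤ_p)` (`â` the least non-negative lift) is a Cauchy
sequence (uniform continuity of `φ` on the compact ℤ_p + the compatibility of `d` + the ultrametric
inequality: `‖riemann (k+1) − riemann k‖ ≤ ω_φ(p^{-k}) · bound`), its limit `ofDistribution d φ`
is `A`-linear and bounded by `bound · ‖φ‖`, and on the indicator of a residue class the Riemann sums
are eventually constant, equal to the distribution's value (`dist_ofDistribution`).  Hence
**`toDistribution_ofDistribution_val`** / **`ofDistribution_toDistribution`** /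
**`exists_measure_of_distribution`**: bounded functionals on C(ℤ_p, A) ↔ bounded compatible systems
on the quotients ℤ/p^k — the kernel form of «a W-valued measure on ℤ_p is an element of
lim_k W[ℤ/p^k] = W[[ℤ_p]]», for any complete ultrametric `A` (W included).

No printed input is consumed.  §8(d): uses an L-value-free non-vanishing device: NO.
-/

namespace Summit.Ventures.HodgeRepro2.T5DistributionMeasure

open Summit.Ventures.HodgeRepro2.T5MeasureSupOnClopens (indicatorCM indicatorCM_apply)
open Summit.Ventures.HodgeRepro2.T5MuInvariantPadicCosets (coset mem_coset_iff_toZModPow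
  mem_coset_iff_norm exists_pow_neg_lt)
open Summit.Ventures.HodgeRepro2.T5MeasureDistribution
open Finset Filter Topology

variable {p : ℕ} [Fact (Nat.Prime p)]

section Lift

/-- The least non-negative lift of `a : ℤ/p^k` to ℤ_p. -/
noncomputable def lift (k : ℕ) (a : ZMod (p ^ k)) : ℤ_[p] := ((a.val : ℕ) : ℤ_[p])

/-- `lift k a` reduces to `a`. -/
@[simp] theorem toZModPow_lift (k : ℕ) (a : ZMod (p ^ k)) :
    PadicInt.toZModPow k (lift k a) = a := by
  simp [lift]

/-- `lift k a ∈ resClass k a`. -/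
theorem lift_mem_resClass (k : ℕ) (a : ZMod (p ^ k)) : lift k a ∈ resClass k a :=
  toZModPow_lift k a

/-- The level-`k` reduction of a lift from level `k + 1` is the cast. -/
theorem toZModPow_lift_succ (k : ℕ) (b : ZMod (p ^ (k + 1))) :
    PadicInt.toZModPow k (lift (k + 1) b) = (b.cast : ZMod (p ^ k)) := by
  rw [← PadicInt.cast_toZModPow k (k + 1) (Nat.le_succ k), toZModPow_lift]

/-- Lifts of `b` (level `k + 1`) and of its cast (level `k`) are `p^{-k}`-close. -/
theorem norm_lift_sub_lift_cast_le (k : ℕ) (b : ZMod (p ^ (k + 1))) :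
    ‖lift (k + 1) b - lift k (b.cast : ZMod (p ^ k))‖ ≤ (p : ℝ) ^ (-(k : ℤ)) := by
  rw [← mem_coset_iff_norm, mem_coset_iff_toZModPow, toZModPow_lift_succ, toZModPow_lift]

end Lift

section Riemann

variable {A : Type*} [NormedCommRing A]

/-- The level-`k` Riemann sum of `φ` against the distribution `d`:
`Σ_{a ∈ ℤ/p^k} φ(â) · d(a + p^kℤ_p)`. -/
noncomputable def riemann (d : Distribution p A) (φ : C(ℤ_[p], A)) (k : ℕ) : A :=
  ∑ a : ZMod (p ^ k), φ (lift k a) * d.val k a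

/-- The bound of a distribution is non-negative. -/
theorem _root_.Summit.Ventures.HodgeRepro2.T5MeasureDistribution.Distribution.bound_nonneg
    (d : Distribution p A) : 0 ≤ d.bound :=
  (norm_nonneg _).trans (d.norm_le 0 0)

/-- Riemann sums are additive in `φ`. -/
theorem riemann_add (d : Distribution p A) (φ ψ : C(ℤ_[p], A)) (k : ℕ) :
    riemann d (φ + ψ) k = riemann d φ k + riemann d ψ k := by
  simp only [riemann, ContinuousMap.add_apply, add_mul, Finset.sum_add_distrib]

/-- Riemann sums are `A`-linear in `φ`. -/
theorem riemann_smul (d : Distribution p A) (c : A) (φ : C(ℤ_[p], A)) (k : ℕ) :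
    riemann d (c • φ) k = c * riemann d φ k := by
  simp only [riemann, ContinuousMap.smul_apply, smul_eq_mul, mul_assoc, Finset.mul_sum]

/-- The level-`k` Riemann sum rewritten over level `k + 1` through the compatibility of `d`. -/
theorem riemann_eq_sum_succ (d : Distribution p A) (φ : C(ℤ_[p], A)) (k : ℕ) :
    riemann d φ k = ∑ b : ZMod (p ^ (k + 1)), φ (lift k (b.cast : ZMod (p ^ k))) * d.val (k + 1) b := by
  classical
  unfold riemann
  rw [← Finset.sum_fiberwise univ (fun b : ZMod (p ^ (k + 1)) => (b.cast : ZMod (p ^ k)))]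
  refine Finset.sum_congr rfl fun a _ => ?_
  rw [d.compat k a, Finset.mul_sum]
  refine Finset.sum_congr rfl fun b hb => ?_
  rw [(Finset.mem_filter.1 hb).2]

/-- `riemann (k+1) − riemann k = Σ_b (φ(b̂) − φ(ĉast b)) · d(b + p^{k+1}ℤ_p)`. -/
theorem riemann_succ_sub (d : Distribution p A) (φ : C(ℤ_[p], A)) (k : ℕ) :
    riemann d φ (k + 1) - riemann d φ k =
      ∑ b : ZMod (p ^ (k + 1)),
        (φ (lift (k + 1) b) - φ (lift k (b.cast : ZMod (p ^ k)))) * d.val (k + 1) b := by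
  rw [riemann_eq_sum_succ d φ k]
  unfold riemann
  rw [← Finset.sum_sub_distrib]
  refine Finset.sum_congr rfl fun b _ => ?_
  rw [sub_mul]

/-- Telescoping: `riemann n − riemann N = Σ_{j ∈ [N, n)} (riemann (j+1) − riemann j)`. -/
theorem riemann_sub_eq_sum_Ico (d : Distribution p A) (φ : C(ℤ_[p], A)) {N n : ℕ} (h : N ≤ n) :
    riemann d φ n - riemann d φ N =
      ∑ j ∈ Finset.Ico N n, (riemann d φ (j + 1) - riemann d φ j) := by
  rw [Finset.sum_Ico_eq_sub _ h, Finset.sum_range_sub, Finset.sum_range_sub]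
  abel

variable [IsUltrametricDist A]

/-- `‖riemann d φ k‖ ≤ bound · ‖φ‖` (ultrametric sum of terms bounded by `‖φ‖ · bound`). -/
theorem norm_riemann_le (d : Distribution p A) (φ : C(ℤ_[p], A)) (k : ℕ) :
    ‖riemann d φ k‖ ≤ d.bound * ‖φ‖ := by
  refine IsUltrametricDist.norm_sum_le_of_forall_le_of_nonneg
    (mul_nonneg d.bound_nonneg (norm_nonneg φ)) fun a _ => ?_
  calc ‖φ (lift k a) * d.val k a‖ ≤ ‖φ (lift k a)‖ * ‖d.val k a‖ := norm_mul_le _ _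
    _ ≤ ‖φ‖ * d.bound :=
        mul_le_mul (ContinuousMap.norm_coe_le_norm φ _) (d.norm_le k a) (norm_nonneg _)
          (norm_nonneg _)
    _ = d.bound * ‖φ‖ := mul_comm _ _

/-- The modulus-of-continuity bound on consecutive Riemann sums: if `φ` varies by at most `ε` on
`p^{-k}`-close points then `‖riemann (k+1) − riemann k‖ ≤ ε · bound`. -/
theorem norm_riemann_succ_sub_le (d : Distribution p A) (φ : C(ℤ_[p], A)) {ε : ℝ} (hε : 0 ≤ ε)
    {k : ℕ} (h : ∀ x y : ℤ_[p], ‖x - y‖ ≤ (p : ℝ) ^ (-(k : ℤ)) → ‖φ x - φ y‖ ≤ ε) :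
    ‖riemann d φ (k + 1) - riemann d φ k‖ ≤ ε * d.bound := by
  rw [riemann_succ_sub]
  refine IsUltrametricDist.norm_sum_le_of_forall_le_of_nonneg (mul_nonneg hε d.bound_nonneg)
    fun b _ => ?_
  calc ‖(φ (lift (k + 1) b) - φ (lift k (b.cast : ZMod (p ^ k)))) * d.val (k + 1) b‖
      ≤ ‖φ (lift (k + 1) b) - φ (lift k (b.cast : ZMod (p ^ k)))‖ * ‖d.val (k + 1) b‖ :=
        norm_mul_le _ _
    _ ≤ ε * d.bound :=
        mul_le_mul (h _ _ (norm_lift_sub_lift_cast_le k b)) (d.norm_le _ _) (norm_nonneg _) hε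

/-- THE RIEMANN SUMS ARE CAUCHY: uniform continuity of `φ` on the compact ℤ_p, the
consecutive-difference bound and the ultrametric inequality on the telescoping sum. -/
theorem cauchySeq_riemann (d : Distribution p A) (φ : C(ℤ_[p], A)) : CauchySeq (riemann d φ) := by
  rw [Metric.cauchySeq_iff']
  intro ε hε
  set ε' : ℝ := ε / (d.bound + 1) with hε'
  have hB : 0 < d.bound + 1 := by linarith [d.bound_nonneg]
  have hε'pos : 0 < ε' := div_pos hε hB
  obtain ⟨δ, hδ, hφ⟩ := Metric.uniformContinuous_iff.1
    (CompactSpace.uniformContinuous_of_continuous φ.continuous) ε' hε'pos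
  obtain ⟨N, hN⟩ := exists_pow_neg_lt (p := p) hδ
  refine ⟨N, fun n hn => ?_⟩
  have hstep : ∀ j, N ≤ j → ‖riemann d φ (j + 1) - riemann d φ j‖ ≤ ε' * d.bound := by
    intro j hj
    refine norm_riemann_succ_sub_le d φ hε'pos.le fun x y hxy => ?_
    have hp1 : (1 : ℝ) ≤ (p : ℝ) := by exact_mod_cast (Fact.out : Nat.Prime p).one_lt.le
    have hlt : ‖x - y‖ < δ := by
      calc ‖x - y‖ ≤ (p : ℝ) ^ (-(j : ℤ)) := hxy
        _ ≤ (p : ℝ) ^ (-(N : ℤ)) := zpow_le_zpow_right₀ hp1 (by omega)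
        _ < δ := hN
    have := hφ (show dist x y < δ by rwa [dist_eq_norm])
    rw [dist_eq_norm] at this
    exact this.le
  rw [dist_eq_norm, riemann_sub_eq_sum_Ico d φ hn]
  calc ‖∑ j ∈ Finset.Ico N n, (riemann d φ (j + 1) - riemann d φ j)‖ ≤ ε' * d.bound :=
        IsUltrametricDist.norm_sum_le_of_forall_le_of_nonneg
          (mul_nonneg hε'pos.le d.bound_nonneg)
          fun j hj => hstep j (Finset.mem_Ico.1 hj).1
    _ < ε := by
        rw [hε', div_mul_eq_mul_div, div_lt_iff₀ hB]
        nlinarith [d.bound_nonneg]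

end Riemann

section OfDistribution

variable {A : Type*} [NormedCommRing A] [IsUltrametricDist A] [CompleteSpace A]

/-- The limit of the Riemann sums. -/
noncomputable def limitRiemann (d : Distribution p A) (φ : C(ℤ_[p], A)) : A :=
  atTop.limUnder (riemann d φ)

/-- The Riemann sums converge to `limitRiemann d φ`. -/
theorem tendsto_riemann (d : Distribution p A) (φ : C(ℤ_[p], A)) :
    Tendsto (riemann d φ) atTop (𝓝 (limitRiemann d φ)) :=
  (cauchySeq_riemann d φ).tendsto_limUnder

/-- THE MEASURE OF A DISTRIBUTION: `φ ↦ lim_k Σ_{a ∈ ℤ/p^k} φ(â) d(a + p^kℤ_p)`, `A`-linear. -/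
noncomputable def ofDistribution (d : Distribution p A) : C(ℤ_[p], A) →ₗ[A] A where
  toFun φ := limitRiemann d φ
  map_add' φ ψ := by
    refine tendsto_nhds_unique (tendsto_riemann d (φ + ψ)) ?_
    have h := (tendsto_riemann d φ).add (tendsto_riemann d ψ)
    refine h.congr' (Eventually.of_forall fun k => ?_)
    exact (riemann_add d φ ψ k).symm
  map_smul' c φ := by
    refine tendsto_nhds_unique (tendsto_riemann d (c • φ)) ?_
    have h := (tendsto_riemann d φ).const_mul c
    refine h.congr' (Eventually.of_forall fun k => ?_)
    exact (riemann_smul d c φ k).symm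

/-- `ofDistribution d φ = limitRiemann d φ`. -/
theorem ofDistribution_apply (d : Distribution p A) (φ : C(ℤ_[p], A)) :
    ofDistribution d φ = limitRiemann d φ := rfl

/-- The measure of a distribution is bounded by its bound. -/
theorem norm_ofDistribution_le (d : Distribution p A) (φ : C(ℤ_[p], A)) :
    ‖ofDistribution d φ‖ ≤ d.bound * ‖φ‖ :=
  le_of_tendsto' (tendsto_riemann d φ).norm fun k => norm_riemann_le d φ k

/-- The cast `ℤ/p^l → ℤ/p^k` for `k ≤ l` read through the lifts. -/
theorem toZModPow_lift_of_le {k l : ℕ} (h : k ≤ l) (b : ZMod (p ^ l)) :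
    PadicInt.toZModPow k (lift l b) = (b.cast : ZMod (p ^ k)) := by
  rw [← PadicInt.cast_toZModPow k l h, toZModPow_lift]

/-- Casting `ℤ/p^{l+1} → ℤ/p^k` factors through `ℤ/p^l` (`k ≤ l`). -/
theorem cast_cast_eq {k l : ℕ} (hkl : k ≤ l) (b : ZMod (p ^ (l + 1))) :
    (b.cast : ZMod (p ^ k)) = ((b.cast : ZMod (p ^ l)).cast : ZMod (p ^ k)) := by
  rw [← toZModPow_lift_of_le (Nat.le_succ l) b, PadicInt.cast_toZModPow k l hkl,
    toZModPow_lift_of_le (hkl.trans (Nat.le_succ l))]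

omit [IsUltrametricDist A] [CompleteSpace A] in
/-- Iterated compatibility: the value at level `k` is the sum of the values at any level `l ≥ k`
over the classes lying above. -/
theorem _root_.Summit.Ventures.HodgeRepro2.T5MeasureDistribution.Distribution.val_eq_sum_of_le
    (d : Distribution p A) {k l : ℕ} (h : k ≤ l) (a : ZMod (p ^ k)) :
    d.val k a = ∑ b ∈ univ.filter (fun b : ZMod (p ^ l) => (b.cast : ZMod (p ^ k)) = a), d.val l b := by
  classical
  induction l, h using Nat.le_induction with
  | base =>
    rw [Finset.sum_filter]
    simp only [ZMod.cast_id]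
    rw [Finset.sum_ite_eq' univ a (fun b => d.val k b)]
    simp
  | succ l hkl ih =>
    rw [ih, Finset.sum_congr rfl (fun b _ => d.compat l b)]
    simp_rw [cast_cast_eq hkl]
    rw [← Finset.sum_fiberwise_of_maps_to
      (s := univ.filter fun b' : ZMod (p ^ (l + 1)) => ((b'.cast : ZMod (p ^ l)).cast : ZMod (p ^ k)) = a)
      (t := univ.filter fun b : ZMod (p ^ l) => (b.cast : ZMod (p ^ k)) = a)
      (g := fun b' : ZMod (p ^ (l + 1)) => (b'.cast : ZMod (p ^ l)))
      (fun b' hb' => Finset.mem_filter.2 ⟨Finset.mem_univ _, (Finset.mem_filter.1 hb').2⟩)]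
    refine Finset.sum_congr rfl fun b hb => Finset.sum_congr ?_ fun _ _ => rfl
    ext c
    simp only [Finset.mem_filter, Finset.mem_univ, true_and]
    constructor
    · intro hc
      refine ⟨?_, hc⟩
      rw [hc]
      exact (Finset.mem_filter.1 hb).2
    · exact fun hc => hc.2

omit [IsUltrametricDist A] [CompleteSpace A] in
/-- On the indicator of a residue class of level `k` the Riemann sums of level `l ≥ k` are the
value `d(a + p^kℤ_p)` itself. -/
theorem riemann_indicatorCM_resClass (d : Distribution p A) {k l : ℕ} (h : k ≤ l)
    (a : ZMod (p ^ k)) : riemann d (indicatorCM (resClass k a)) l = d.val k a := by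
  classical
  unfold riemann
  rw [d.val_eq_sum_of_le h a, Finset.sum_filter]
  refine Finset.sum_congr rfl fun b _ => ?_
  rw [indicatorCM_apply (isClopen_resClass k a), Set.indicator_apply, mem_resClass_iff,
    toZModPow_lift_of_le h b]
  split_ifs <;> simp

/-- The measure of a distribution has the distribution's values on the residue classes. -/
theorem dist_ofDistribution (d : Distribution p A) (k : ℕ) (a : ZMod (p ^ k)) :
    dist (ofDistribution d) k a = d.val k a := by
  rw [dist_apply, ofDistribution_apply]
  refine tendsto_nhds_unique (tendsto_riemann d _) ?_
  refine tendsto_const_nhds.congr' ?_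
  rw [EventuallyEq, eventually_atTop]
  exact ⟨k, fun l hl => (riemann_indicatorCM_resClass d hl a).symm⟩

/-- `dist (ofDistribution d) = d.val`. -/
theorem dist_ofDistribution_eq (d : Distribution p A) : dist (ofDistribution d) = d.val :=
  funext fun k => funext fun a => dist_ofDistribution d k a

/-- SURJECTIVITY: every bounded compatible system of values on the residue classes is the
distribution of a bounded measure. -/
theorem exists_measure_of_distribution (d : Distribution p A) :
    ∃ m : C(ℤ_[p], A) →ₗ[A] A, (∀ φ : C(ℤ_[p], A), ‖m φ‖ ≤ d.bound * ‖φ‖) ∧ dist m = d.val :=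
  ⟨ofDistribution d, norm_ofDistribution_le d, dist_ofDistribution_eq d⟩

variable [NormOneClass A]

/-- `toDistribution (ofDistribution d)` has the values of `d`. -/
theorem toDistribution_ofDistribution_val (d : Distribution p A) :
    (toDistribution (ofDistribution d) d.bound_nonneg (norm_ofDistribution_le d)).val = d.val :=
  dist_ofDistribution_eq d

/-- `ofDistribution (toDistribution m) = m`: the two constructions are inverse to each other on
bounded measures (injectivity of `toDistribution`, §(T5MeasureDistribution)). -/
theorem ofDistribution_toDistribution (m : C(ℤ_[p], A) →ₗ[A] A) {C : ℝ} (hC : 0 ≤ C)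
    (hm : ∀ φ : C(ℤ_[p], A), ‖m φ‖ ≤ C * ‖φ‖) :
    ofDistribution (toDistribution m hC hm) = m :=
  eq_of_dist_eq _ m hC (norm_ofDistribution_le _) hm fun k a => dist_ofDistribution _ k a

/-- The two constructions are inverse bijections between bounded measures (bounded by `C`) and
bounded compatible systems (bounded by `C`): the set-level form of `A[[ℤ_p]] ≅ lim_k A[ℤ/p^k]`. -/
theorem bijective_dist_on_bounded {C : ℝ} (hC : 0 ≤ C) :
    Set.BijOn (fun m : C(ℤ_[p], A) →ₗ[A] A => dist m)
      {m | ∀ φ : C(ℤ_[p], A), ‖m φ‖ ≤ C * ‖φ‖}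
      {v : ∀ k : ℕ, ZMod (p ^ k) → A | (∀ (k : ℕ) (a : ZMod (p ^ k)),
        v k a = ∑ b ∈ univ.filter (fun b : ZMod (p ^ (k + 1)) => (b.cast : ZMod (p ^ k)) = a), v (k + 1) b) ∧
        ∀ (k : ℕ) (a : ZMod (p ^ k)), ‖v k a‖ ≤ C} := by
  refine ⟨fun m hm => ⟨dist_compat m, norm_dist_le m hC hm⟩, fun m₁ hm₁ m₂ hm₂ h => ?_, ?_⟩
  · exact eq_of_dist_eq m₁ m₂ hC hm₁ hm₂ fun k a => by
      have := congrFun (congrFun h k) a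
      exact this
  · rintro v ⟨hcompat, hbound⟩
    let d : Distribution p A := ⟨v, hcompat, C, hbound⟩
    exact ⟨ofDistribution d, norm_ofDistribution_le d, dist_ofDistribution_eq d⟩

end OfDistribution

end Summit.Ventures.HodgeRepro2.T5DistributionMeasure
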